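import Summits.CriticalPhenomena.PercolationContinuityZ3.Theorems.PercNearOneGluingAdditiveGluingConnAtoms
import HarnessLib

/-!
# `NoHeavyLowerTail` (crux stmt-CriticalPhenomena-4575) — four-point connectivity atoms: the 15-cell law of `(a, b, c, y)` and the
# dictionary "event probability = sum of cells" for every event of the SHK3⁺ terminal-edge step

Support file (prover seat `prim-bnk-1`, bounded-n kernel lane, gen 3; `--supports stmt-CriticalPhenomena-4575`).  Bookkeeping only:
two small definitions (`pat4`, `cell`), no named facts, no sorries, no `native_decide` (the two table facts `image_pat4`,
`pat4_injective` are `decide +kernel`).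

PURPOSE.  The polarised rows (L1) `PolarisedRowL1`, (L2) `PolarisedRowL2` (`…GroupSepHybridRows`), the Bernstein pieces (B1),(B2)
(`CubicThreePointStep.threeB₁/threeB₂` at the event probabilities, `…TerminalEdgeStepLeFive`), the hybrid / group three-point rows and
SHK3⁺ are all statements about probabilities of events READ OFF the connectivity pattern of four marked vertices `a, b, c, y` under
`μ = prodBernoulli w`.  The cell-level algebra relating them is in the tree (`CubicThreePointStep.threeB₁_polarization`,
`CubicFourPoint.threeB₁_eq_polL₁`, `threeB₂_eq_polL₂`, `polL₂_eq_polL₁_add`, prim-ineq-harness-2 / prim-l12-p6); what was missing is the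
MEASURE ↔ CELLS dictionary for four points, uniformly for every finite vertex type.  This file supplies it on top of the general
connectivity-atom machinery `…AdditiveGluingConnAtoms` (`atom`, `HasPattern`, `measureReal_eq_sum_atoms`, any `k`, any `V`):

* `pat4 : Fin 15 → (Fin 4 → Fin 4)` — the 15 canonical labelings of four points, listed in the CELL ORDER of
  `threeB₁_polarization` / `CubicFourPoint.polL₁`:
  `a|b|c|y, a|b|cy, a|by|c, a|bc|y, ay|b|c, ac|b|y, ab|c|y, a|bcy, ay|bc, ac|by, acy|b, ab|cy, aby|c, abc|y, abcy`
  (`image_pat4 : univ.image pat4 = canonSet 4`, `pat4_injective`, `card_canonSet_four = 15`);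
* `cell w a b c y i = μ(atom (a,b,c,y) (pat4 i))`, `cell_nonneg`, `sum_cell_eq_one` (in the fixed left-associated order, so that the
  total-mass factor `σ` of the homogeneous cell forms rewrites to `1` syntactically);
* `measureReal_eq_cellSum` — an event with `HasPattern` is the explicit 15-term indicator sum of cells; and the DICTIONARY
  `real_<tag>`: every event occurring in (L1), (L2), the shape-(i) group row `E₃(D[ay|b], D[ay|c], D_bc)`, SHK3⁺ on `(a,b,c)`, the
  three Harris terms of the polarization identities, the three-point law `(q,u₁,u₂,u₃,t)` of `(a,b,c)` and the five apex transition
  events `(α₁,α₂,β₁,β₂,β₃)`, each as an explicit sum of cells (proved uniformly: atom decomposition + `decide` on the 15 patterns + `ring`).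
Consumer: `…TerminalEdgeStepOfL1` ((L1) ⇒ (L2), (B1), (B2) on every finite weighted graph).  No distinctness of `a, b, c, y` is needed
anywhere (coincident points only empty some cells).
-/

noncomputable section

namespace Summit.CriticalPhenomena.PercolationContinuityZ3.Theorems

open MeasureTheory Set Literature.Probability.Percolation
open Literature.Probability.LatticeModels (prodBernoulli)
open Summit.CriticalPhenomena.PercolationContinuityZ3.Cruxes.AdditiveGluing.TieLine.ConnAtoms

namespace FourPointAtoms

/-! ## The 15 patterns of four points -/

/-- The 15 canonical labelings of `Fin 4` (set partitions of the four marked points `a,b,c,y` = indices `0,1,2,3`), in the cell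
order of `CubicThreePointStep.threeB₁_polarization` / `CubicFourPoint.polL₁`:
`a|b|c|y, a|b|cy, a|by|c, a|bc|y, ay|b|c, ac|b|y, ab|c|y, a|bcy, ay|bc, ac|by, acy|b, ab|cy, aby|c, abc|y, abcy`. [this work] -/
def pat4 : Fin 15 → Fin 4 → Fin 4 := ![
  ![0, 1, 2, 3], ![0, 1, 2, 2], ![0, 1, 2, 1], ![0, 1, 1, 3], ![0, 1, 2, 0],
  ![0, 1, 0, 3], ![0, 0, 2, 3], ![0, 1, 1, 1], ![0, 1, 1, 0], ![0, 1, 0, 1],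
  ![0, 1, 0, 0], ![0, 0, 2, 2], ![0, 0, 2, 0], ![0, 0, 0, 3], ![0, 0, 0, 0]]

/-- The table `pat4` enumerates exactly the canonical labelings of `Fin 4` (kernel computation). [this work] -/
theorem image_pat4 : Finset.univ.image pat4 = canonSet 4 := by decide +kernel

/-- The table `pat4` has no repetitions (kernel computation). [this work] -/
theorem pat4_injective : Function.Injective pat4 := by unfold Function.Injective; decide +kernel

/-- There are `B₄ = 15` connectivity patterns of four points. [folklore] -/
theorem card_canonSet_four : (canonSet 4).card = 15 := by
  rw [← image_pat4, Finset.card_image_of_injective _ pat4_injective, Finset.card_univ, Fintype.card_fin]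

/-- A sum over `Fin 15`, written out (fixed left-associated order). [folklore] -/
theorem sum_fin15 (f : Fin 15 → ℝ) :
    ∑ i, f i = f 0 + f 1 + f 2 + f 3 + f 4 + f 5 + f 6 + f 7 + f 8 + f 9 + f 10 + f 11 + f 12 + f 13 + f 14 := by
  have h : ∑ i, f i = f 0 + (f 1 + (f 2 + (f 3 + (f 4 + (f 5 + (f 6 + (f 7 + (f 8 + (f 9 + (f 10 + (f 11 + (f 12 +
      (f 13 + f 14))))))))))))) := by
    simp only [Fin.sum_univ_succ, Fin.sum_univ_zero, add_zero]
    rfl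
  rw [h]
  simp only [add_assoc]

/-! ## Cells of the four marked points -/

variable {V : Type*}

/-- The four marked points as a map `Fin 4 → V` (index `0 = a`, `1 = b`, `2 = c`, `3 = y`). [this work] -/
abbrev quad (a b c y : V) : Fin 4 → V := ![a, b, c, y]

/-- `{x ↔ z}` for marked points `x = quad i`, `z = quad j` has pattern `π i = π j`. [folklore] -/
theorem oc (a b c y : V) (i j : Fin 4) {x z : V} (hx : quad a b c y i = x) (hz : quad a b c y j = z) :
    HasPattern (quad a b c y) (openConn x z) fun π => π i = π j :=
  HasPattern.openConn_of_eq hx hz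

variable [Fintype V]

/-- **Cell masses of the four-point connectivity law**: `cell w a b c y i = μ(atom of pattern pat4 i)` for `μ = prodBernoulli w` and the
marked points `(a, b, c, y)`; e.g. `cell … 7 = μ(a|bcy)` is the mass of "`a` cut off, `b, c, y` in one open cluster". [this work] -/
def cell (w : Sym2 V → unitInterval) (a b c y : V) (i : Fin 15) : ℝ :=
  (prodBernoulli w).real (atom (quad a b c y) (pat4 i))

variable (w : Sym2 V → unitInterval) (a b c y : V)

omit [Fintype V] in
/-- Cells are nonnegative. [folklore] -/
theorem cell_nonneg (i : Fin 15) : 0 ≤ cell w a b c y i := measureReal_nonneg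

/-- **Atom decomposition in cell form**: an event read off the four-point pattern is the explicit indicator sum of its cells. [this work] -/
theorem measureReal_eq_cellSum {E : Set (BondConfig V)} {Φ : (Fin 4 → Fin 4) → Prop} [DecidablePred Φ]
    (h : HasPattern (quad a b c y) E Φ) :
    (prodBernoulli w).real E =
      (if Φ (pat4 0) then cell w a b c y 0 else 0) + (if Φ (pat4 1) then cell w a b c y 1 else 0) +
      (if Φ (pat4 2) then cell w a b c y 2 else 0) + (if Φ (pat4 3) then cell w a b c y 3 else 0) +
      (if Φ (pat4 4) then cell w a b c y 4 else 0) + (if Φ (pat4 5) then cell w a b c y 5 else 0) +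
      (if Φ (pat4 6) then cell w a b c y 6 else 0) + (if Φ (pat4 7) then cell w a b c y 7 else 0) +
      (if Φ (pat4 8) then cell w a b c y 8 else 0) + (if Φ (pat4 9) then cell w a b c y 9 else 0) +
      (if Φ (pat4 10) then cell w a b c y 10 else 0) + (if Φ (pat4 11) then cell w a b c y 11 else 0) +
      (if Φ (pat4 12) then cell w a b c y 12 else 0) + (if Φ (pat4 13) then cell w a b c y 13 else 0) +
      (if Φ (pat4 14) then cell w a b c y 14 else 0) := by
  rw [measureReal_eq_sum_atoms (quad a b c y) _ h, sum_filter_canonSet_eq_of_enum image_pat4 pat4_injective,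
    Finset.sum_filter, sum_fin15]
  rfl

/-- **The cells sum to one** (in the fixed left-associated order used by the cell forms `CubicFourPoint.polL₁` etc.). [this work] -/
theorem sum_cell_eq_one :
    cell w a b c y 0 + cell w a b c y 1 + cell w a b c y 2 + cell w a b c y 3 + cell w a b c y 4 + cell w a b c y 5 +
      cell w a b c y 6 + cell w a b c y 7 + cell w a b c y 8 + cell w a b c y 9 + cell w a b c y 10 + cell w a b c y 11 +
      cell w a b c y 12 + cell w a b c y 13 + cell w a b c y 14 = 1 := by
  have h := measureReal_eq_cellSum w a b c y (HasPattern.univ (p := quad a b c y))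
  rw [probReal_univ] at h
  rw [h]
  simp only [ite_true]

/-! ## The dictionary: events of the terminal-edge step as sums of cells

Naming: `hyb1_*` the seven events of `E₃(D_bc, D_ac, D[ay|b])` (slots `A, B, C` and their intersections, exactly as `sahiE3_def`
unfolds them in `PolarisedRowL1`), `hyb2_*` of `E₃(D_bc, D[ay|c], D_ab)`, `hyb3_*` of the shape-(i) row `E₃(D_bc, D[ay|c], D[ay|b])` of
`PolarisedRowL2`, `grp_*` of the same row in the orientation produced by `GroupThreePointLB.sahiE3_groupPairSep_nonneg` with
`A = {a,y}`, `B = {b}`, vertex `c`; `shk_*` of SHK3⁺ on `(a,b,c)`; `beta` = `μ(a|bcy)`, `Gbc` = `μ(G_bc)`; `lu1 … lb3` the three-point cells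
and apex transition events of `…ThreePointRowsLeFive` / `…TerminalEdgeStepLeFive` (`connEvent_pQ`, …, `connEvent_pB₃`). -/

/-- `μ((openConn b c)ᶜ ∩ (openConn a c)ᶜ ∩ ((openConn b a)ᶜ ∩ (openConn b y)ᶜ))` as a sum of four-point cells. [this work] -/
theorem real_hyb1_ABC : (prodBernoulli w).real ((openConn b c)ᶜ ∩ (openConn a c)ᶜ ∩ ((openConn b a)ᶜ ∩ (openConn b y)ᶜ)) =
    cell w a b c y 0 + cell w a b c y 1 + cell w a b c y 4 := by
  rw [measureReal_eq_cellSum w a b c y (show HasPattern (quad a b c y) ((openConn b c)ᶜ ∩ (openConn a c)ᶜ ∩ ((openConn b a)ᶜ ∩ (openConn b y)ᶜ)) _ from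
    (((oc a b c y 1 2 rfl rfl).compl.inter (oc a b c y 0 2 rfl rfl).compl).inter ((oc a b c y 1 0 rfl rfl).compl.inter (oc a b c y 1 3 rfl rfl).compl)))]
  simp (config := {decide := true}) only [ite_true, ite_false]; ring

/-- `μ((openConn b c)ᶜ)` as a sum of four-point cells. [this work] -/
theorem real_hyb1_A : (prodBernoulli w).real (openConn b c)ᶜ =
    cell w a b c y 0 + cell w a b c y 1 + cell w a b c y 2 + cell w a b c y 4 + cell w a b c y 5 + cell w a b c y 6 + cell w a b c y 9 + cell w a b c y 10 + cell w a b c y 11 + cell w a b c y 12 := by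
  rw [measureReal_eq_cellSum w a b c y (show HasPattern (quad a b c y) ((openConn b c)ᶜ) _ from
    (oc a b c y 1 2 rfl rfl).compl)]
  simp (config := {decide := true}) only [ite_true, ite_false]; ring

/-- `μ((openConn a c)ᶜ)` as a sum of four-point cells. [this work] -/
theorem real_hyb1_B : (prodBernoulli w).real (openConn a c)ᶜ =
    cell w a b c y 0 + cell w a b c y 1 + cell w a b c y 2 + cell w a b c y 3 + cell w a b c y 4 + cell w a b c y 6 + cell w a b c y 7 + cell w a b c y 8 + cell w a b c y 11 + cell w a b c y 12 := by
  rw [measureReal_eq_cellSum w a b c y (show HasPattern (quad a b c y) ((openConn a c)ᶜ) _ from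
    (oc a b c y 0 2 rfl rfl).compl)]
  simp (config := {decide := true}) only [ite_true, ite_false]; ring

/-- `μ((openConn b a)ᶜ ∩ (openConn b y)ᶜ)` as a sum of four-point cells. [this work] -/
theorem real_hyb1_C : (prodBernoulli w).real ((openConn b a)ᶜ ∩ (openConn b y)ᶜ) =
    cell w a b c y 0 + cell w a b c y 1 + cell w a b c y 3 + cell w a b c y 4 + cell w a b c y 5 + cell w a b c y 8 + cell w a b c y 10 := by
  rw [measureReal_eq_cellSum w a b c y (show HasPattern (quad a b c y) ((openConn b a)ᶜ ∩ (openConn b y)ᶜ) _ from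
    ((oc a b c y 1 0 rfl rfl).compl.inter (oc a b c y 1 3 rfl rfl).compl))]
  simp (config := {decide := true}) only [ite_true, ite_false]; ring

/-- `μ((openConn a c)ᶜ ∩ ((openConn b a)ᶜ ∩ (openConn b y)ᶜ))` as a sum of four-point cells. [this work] -/
theorem real_hyb1_BC : (prodBernoulli w).real ((openConn a c)ᶜ ∩ ((openConn b a)ᶜ ∩ (openConn b y)ᶜ)) =
    cell w a b c y 0 + cell w a b c y 1 + cell w a b c y 3 + cell w a b c y 4 + cell w a b c y 8 := by
  rw [measureReal_eq_cellSum w a b c y (show HasPattern (quad a b c y) ((openConn a c)ᶜ ∩ ((openConn b a)ᶜ ∩ (openConn b y)ᶜ)) _ from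
    ((oc a b c y 0 2 rfl rfl).compl.inter ((oc a b c y 1 0 rfl rfl).compl.inter (oc a b c y 1 3 rfl rfl).compl)))]
  simp (config := {decide := true}) only [ite_true, ite_false]; ring

/-- `μ((openConn b c)ᶜ ∩ ((openConn b a)ᶜ ∩ (openConn b y)ᶜ))` as a sum of four-point cells. [this work] -/
theorem real_hyb1_AC : (prodBernoulli w).real ((openConn b c)ᶜ ∩ ((openConn b a)ᶜ ∩ (openConn b y)ᶜ)) =
    cell w a b c y 0 + cell w a b c y 1 + cell w a b c y 4 + cell w a b c y 5 + cell w a b c y 10 := by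
  rw [measureReal_eq_cellSum w a b c y (show HasPattern (quad a b c y) ((openConn b c)ᶜ ∩ ((openConn b a)ᶜ ∩ (openConn b y)ᶜ)) _ from
    ((oc a b c y 1 2 rfl rfl).compl.inter ((oc a b c y 1 0 rfl rfl).compl.inter (oc a b c y 1 3 rfl rfl).compl)))]
  simp (config := {decide := true}) only [ite_true, ite_false]; ring

/-- `μ((openConn b c)ᶜ ∩ (openConn a c)ᶜ)` as a sum of four-point cells. [this work] -/
theorem real_hyb1_AB : (prodBernoulli w).real ((openConn b c)ᶜ ∩ (openConn a c)ᶜ) =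
    cell w a b c y 0 + cell w a b c y 1 + cell w a b c y 2 + cell w a b c y 4 + cell w a b c y 6 + cell w a b c y 11 + cell w a b c y 12 := by
  rw [measureReal_eq_cellSum w a b c y (show HasPattern (quad a b c y) ((openConn b c)ᶜ ∩ (openConn a c)ᶜ) _ from
    ((oc a b c y 1 2 rfl rfl).compl.inter (oc a b c y 0 2 rfl rfl).compl))]
  simp (config := {decide := true}) only [ite_true, ite_false]; ring

/-- `μ((openConn b c)ᶜ ∩ ((openConn c a)ᶜ ∩ (openConn c y)ᶜ) ∩ (openConn a b)ᶜ)` as a sum of four-point cells. [this work] -/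
theorem real_hyb2_ABC : (prodBernoulli w).real ((openConn b c)ᶜ ∩ ((openConn c a)ᶜ ∩ (openConn c y)ᶜ) ∩ (openConn a b)ᶜ) =
    cell w a b c y 0 + cell w a b c y 2 + cell w a b c y 4 := by
  rw [measureReal_eq_cellSum w a b c y (show HasPattern (quad a b c y) ((openConn b c)ᶜ ∩ ((openConn c a)ᶜ ∩ (openConn c y)ᶜ) ∩ (openConn a b)ᶜ) _ from
    (((oc a b c y 1 2 rfl rfl).compl.inter ((oc a b c y 2 0 rfl rfl).compl.inter (oc a b c y 2 3 rfl rfl).compl)).inter (oc a b c y 0 1 rfl rfl).compl))]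
  simp (config := {decide := true}) only [ite_true, ite_false]; ring

/-- `μ((openConn c a)ᶜ ∩ (openConn c y)ᶜ)` as a sum of four-point cells. [this work] -/
theorem real_hyb2_B : (prodBernoulli w).real ((openConn c a)ᶜ ∩ (openConn c y)ᶜ) =
    cell w a b c y 0 + cell w a b c y 2 + cell w a b c y 3 + cell w a b c y 4 + cell w a b c y 6 + cell w a b c y 8 + cell w a b c y 12 := by
  rw [measureReal_eq_cellSum w a b c y (show HasPattern (quad a b c y) ((openConn c a)ᶜ ∩ (openConn c y)ᶜ) _ from
    ((oc a b c y 2 0 rfl rfl).compl.inter (oc a b c y 2 3 rfl rfl).compl))]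
  simp (config := {decide := true}) only [ite_true, ite_false]; ring

/-- `μ((openConn a b)ᶜ)` as a sum of four-point cells. [this work] -/
theorem real_hyb2_C : (prodBernoulli w).real (openConn a b)ᶜ =
    cell w a b c y 0 + cell w a b c y 1 + cell w a b c y 2 + cell w a b c y 3 + cell w a b c y 4 + cell w a b c y 5 + cell w a b c y 7 + cell w a b c y 8 + cell w a b c y 9 + cell w a b c y 10 := by
  rw [measureReal_eq_cellSum w a b c y (show HasPattern (quad a b c y) ((openConn a b)ᶜ) _ from
    (oc a b c y 0 1 rfl rfl).compl)]
  simp (config := {decide := true}) only [ite_true, ite_false]; ring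

/-- `μ((openConn c a)ᶜ ∩ (openConn c y)ᶜ ∩ (openConn a b)ᶜ)` as a sum of four-point cells. [this work] -/
theorem real_hyb2_BC : (prodBernoulli w).real ((openConn c a)ᶜ ∩ (openConn c y)ᶜ ∩ (openConn a b)ᶜ) =
    cell w a b c y 0 + cell w a b c y 2 + cell w a b c y 3 + cell w a b c y 4 + cell w a b c y 8 := by
  rw [measureReal_eq_cellSum w a b c y (show HasPattern (quad a b c y) ((openConn c a)ᶜ ∩ (openConn c y)ᶜ ∩ (openConn a b)ᶜ) _ from
    (((oc a b c y 2 0 rfl rfl).compl.inter (oc a b c y 2 3 rfl rfl).compl).inter (oc a b c y 0 1 rfl rfl).compl))]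
  simp (config := {decide := true}) only [ite_true, ite_false]; ring

/-- `μ((openConn b c)ᶜ ∩ (openConn a b)ᶜ)` as a sum of four-point cells. [this work] -/
theorem real_hyb2_AC : (prodBernoulli w).real ((openConn b c)ᶜ ∩ (openConn a b)ᶜ) =
    cell w a b c y 0 + cell w a b c y 1 + cell w a b c y 2 + cell w a b c y 4 + cell w a b c y 5 + cell w a b c y 9 + cell w a b c y 10 := by
  rw [measureReal_eq_cellSum w a b c y (show HasPattern (quad a b c y) ((openConn b c)ᶜ ∩ (openConn a b)ᶜ) _ from
    ((oc a b c y 1 2 rfl rfl).compl.inter (oc a b c y 0 1 rfl rfl).compl))]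
  simp (config := {decide := true}) only [ite_true, ite_false]; ring

/-- `μ((openConn b c)ᶜ ∩ ((openConn c a)ᶜ ∩ (openConn c y)ᶜ))` as a sum of four-point cells. [this work] -/
theorem real_hyb2_AB : (prodBernoulli w).real ((openConn b c)ᶜ ∩ ((openConn c a)ᶜ ∩ (openConn c y)ᶜ)) =
    cell w a b c y 0 + cell w a b c y 2 + cell w a b c y 4 + cell w a b c y 6 + cell w a b c y 12 := by
  rw [measureReal_eq_cellSum w a b c y (show HasPattern (quad a b c y) ((openConn b c)ᶜ ∩ ((openConn c a)ᶜ ∩ (openConn c y)ᶜ)) _ from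
    ((oc a b c y 1 2 rfl rfl).compl.inter ((oc a b c y 2 0 rfl rfl).compl.inter (oc a b c y 2 3 rfl rfl).compl)))]
  simp (config := {decide := true}) only [ite_true, ite_false]; ring

/-- `μ((openConn a b)ᶜ ∩ (openConn b c ∩ openConn b y))` as a sum of four-point cells. [this work] -/
theorem real_beta : (prodBernoulli w).real ((openConn a b)ᶜ ∩ (openConn b c ∩ openConn b y)) =
    cell w a b c y 7 := by
  rw [measureReal_eq_cellSum w a b c y (show HasPattern (quad a b c y) ((openConn a b)ᶜ ∩ (openConn b c ∩ openConn b y)) _ from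
    ((oc a b c y 0 1 rfl rfl).compl.inter ((oc a b c y 1 2 rfl rfl).inter (oc a b c y 1 3 rfl rfl))))]
  simp (config := {decide := true}) only [ite_true, ite_false]; ring

/-- `μ((openConn b c)ᶜ ∩ ((openConn c a)ᶜ ∩ (openConn c y)ᶜ) ∩ ((openConn b a)ᶜ ∩ (openConn b y)ᶜ))` as a sum of four-point cells. [this work] -/
theorem real_hyb3_ABC : (prodBernoulli w).real ((openConn b c)ᶜ ∩ ((openConn c a)ᶜ ∩ (openConn c y)ᶜ) ∩ ((openConn b a)ᶜ ∩ (openConn b y)ᶜ)) =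
    cell w a b c y 0 + cell w a b c y 4 := by
  rw [measureReal_eq_cellSum w a b c y (show HasPattern (quad a b c y) ((openConn b c)ᶜ ∩ ((openConn c a)ᶜ ∩ (openConn c y)ᶜ) ∩ ((openConn b a)ᶜ ∩ (openConn b y)ᶜ)) _ from
    (((oc a b c y 1 2 rfl rfl).compl.inter ((oc a b c y 2 0 rfl rfl).compl.inter (oc a b c y 2 3 rfl rfl).compl)).inter ((oc a b c y 1 0 rfl rfl).compl.inter (oc a b c y 1 3 rfl rfl).compl)))]
  simp (config := {decide := true}) only [ite_true, ite_false]; ring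

/-- `μ((openConn c a)ᶜ ∩ (openConn c y)ᶜ ∩ ((openConn b a)ᶜ ∩ (openConn b y)ᶜ))` as a sum of four-point cells. [this work] -/
theorem real_hyb3_BC : (prodBernoulli w).real ((openConn c a)ᶜ ∩ (openConn c y)ᶜ ∩ ((openConn b a)ᶜ ∩ (openConn b y)ᶜ)) =
    cell w a b c y 0 + cell w a b c y 3 + cell w a b c y 4 + cell w a b c y 8 := by
  rw [measureReal_eq_cellSum w a b c y (show HasPattern (quad a b c y) ((openConn c a)ᶜ ∩ (openConn c y)ᶜ ∩ ((openConn b a)ᶜ ∩ (openConn b y)ᶜ)) _ from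
    (((oc a b c y 2 0 rfl rfl).compl.inter (oc a b c y 2 3 rfl rfl).compl).inter ((oc a b c y 1 0 rfl rfl).compl.inter (oc a b c y 1 3 rfl rfl).compl)))]
  simp (config := {decide := true}) only [ite_true, ite_false]; ring

/-- `μ((openConn b c)ᶜ ∩ (openConn b a ∩ openConn c y)ᶜ ∩ (openConn b y ∩ openConn c a)ᶜ)` as a sum of four-point cells. [this work] -/
theorem real_Gbc : (prodBernoulli w).real ((openConn b c)ᶜ ∩ (openConn b a ∩ openConn c y)ᶜ ∩ (openConn b y ∩ openConn c a)ᶜ) =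
    cell w a b c y 0 + cell w a b c y 1 + cell w a b c y 2 + cell w a b c y 4 + cell w a b c y 5 + cell w a b c y 6 + cell w a b c y 10 + cell w a b c y 12 := by
  rw [measureReal_eq_cellSum w a b c y (show HasPattern (quad a b c y) ((openConn b c)ᶜ ∩ (openConn b a ∩ openConn c y)ᶜ ∩ (openConn b y ∩ openConn c a)ᶜ) _ from
    (((oc a b c y 1 2 rfl rfl).compl.inter ((oc a b c y 1 0 rfl rfl).inter (oc a b c y 2 3 rfl rfl)).compl).inter ((oc a b c y 1 3 rfl rfl).inter (oc a b c y 2 0 rfl rfl)).compl))]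
  simp (config := {decide := true}) only [ite_true, ite_false]; ring

/-- `μ((openConn a b)ᶜ ∩ (openConn y b)ᶜ ∩ ((openConn a c)ᶜ ∩ (openConn y c)ᶜ) ∩ (openConn b c)ᶜ)` as a sum of four-point cells. [this work] -/
theorem real_grp_ABC : (prodBernoulli w).real ((openConn a b)ᶜ ∩ (openConn y b)ᶜ ∩ ((openConn a c)ᶜ ∩ (openConn y c)ᶜ) ∩ (openConn b c)ᶜ) =
    cell w a b c y 0 + cell w a b c y 4 := by
  rw [measureReal_eq_cellSum w a b c y (show HasPattern (quad a b c y) ((openConn a b)ᶜ ∩ (openConn y b)ᶜ ∩ ((openConn a c)ᶜ ∩ (openConn y c)ᶜ) ∩ (openConn b c)ᶜ) _ from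
    ((((oc a b c y 0 1 rfl rfl).compl.inter (oc a b c y 3 1 rfl rfl).compl).inter ((oc a b c y 0 2 rfl rfl).compl.inter (oc a b c y 3 2 rfl rfl).compl)).inter (oc a b c y 1 2 rfl rfl).compl))]
  simp (config := {decide := true}) only [ite_true, ite_false]; ring

/-- `μ((openConn a b)ᶜ ∩ (openConn y b)ᶜ)` as a sum of four-point cells. [this work] -/
theorem real_grp_A : (prodBernoulli w).real ((openConn a b)ᶜ ∩ (openConn y b)ᶜ) =
    cell w a b c y 0 + cell w a b c y 1 + cell w a b c y 3 + cell w a b c y 4 + cell w a b c y 5 + cell w a b c y 8 + cell w a b c y 10 := by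
  rw [measureReal_eq_cellSum w a b c y (show HasPattern (quad a b c y) ((openConn a b)ᶜ ∩ (openConn y b)ᶜ) _ from
    ((oc a b c y 0 1 rfl rfl).compl.inter (oc a b c y 3 1 rfl rfl).compl))]
  simp (config := {decide := true}) only [ite_true, ite_false]; ring

/-- `μ((openConn a c)ᶜ ∩ (openConn y c)ᶜ)` as a sum of four-point cells. [this work] -/
theorem real_grp_B : (prodBernoulli w).real ((openConn a c)ᶜ ∩ (openConn y c)ᶜ) =
    cell w a b c y 0 + cell w a b c y 2 + cell w a b c y 3 + cell w a b c y 4 + cell w a b c y 6 + cell w a b c y 8 + cell w a b c y 12 := by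
  rw [measureReal_eq_cellSum w a b c y (show HasPattern (quad a b c y) ((openConn a c)ᶜ ∩ (openConn y c)ᶜ) _ from
    ((oc a b c y 0 2 rfl rfl).compl.inter (oc a b c y 3 2 rfl rfl).compl))]
  simp (config := {decide := true}) only [ite_true, ite_false]; ring

/-- `μ((openConn a c)ᶜ ∩ (openConn y c)ᶜ ∩ (openConn b c)ᶜ)` as a sum of four-point cells. [this work] -/
theorem real_grp_BC : (prodBernoulli w).real ((openConn a c)ᶜ ∩ (openConn y c)ᶜ ∩ (openConn b c)ᶜ) =
    cell w a b c y 0 + cell w a b c y 2 + cell w a b c y 4 + cell w a b c y 6 + cell w a b c y 12 := by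
  rw [measureReal_eq_cellSum w a b c y (show HasPattern (quad a b c y) ((openConn a c)ᶜ ∩ (openConn y c)ᶜ ∩ (openConn b c)ᶜ) _ from
    (((oc a b c y 0 2 rfl rfl).compl.inter (oc a b c y 3 2 rfl rfl).compl).inter (oc a b c y 1 2 rfl rfl).compl))]
  simp (config := {decide := true}) only [ite_true, ite_false]; ring

/-- `μ((openConn a b)ᶜ ∩ (openConn y b)ᶜ ∩ (openConn b c)ᶜ)` as a sum of four-point cells. [this work] -/
theorem real_grp_AC : (prodBernoulli w).real ((openConn a b)ᶜ ∩ (openConn y b)ᶜ ∩ (openConn b c)ᶜ) =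
    cell w a b c y 0 + cell w a b c y 1 + cell w a b c y 4 + cell w a b c y 5 + cell w a b c y 10 := by
  rw [measureReal_eq_cellSum w a b c y (show HasPattern (quad a b c y) ((openConn a b)ᶜ ∩ (openConn y b)ᶜ ∩ (openConn b c)ᶜ) _ from
    (((oc a b c y 0 1 rfl rfl).compl.inter (oc a b c y 3 1 rfl rfl).compl).inter (oc a b c y 1 2 rfl rfl).compl))]
  simp (config := {decide := true}) only [ite_true, ite_false]; ring

/-- `μ((openConn a b)ᶜ ∩ (openConn y b)ᶜ ∩ ((openConn a c)ᶜ ∩ (openConn y c)ᶜ))` as a sum of four-point cells. [this work] -/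
theorem real_grp_AB : (prodBernoulli w).real ((openConn a b)ᶜ ∩ (openConn y b)ᶜ ∩ ((openConn a c)ᶜ ∩ (openConn y c)ᶜ)) =
    cell w a b c y 0 + cell w a b c y 3 + cell w a b c y 4 + cell w a b c y 8 := by
  rw [measureReal_eq_cellSum w a b c y (show HasPattern (quad a b c y) ((openConn a b)ᶜ ∩ (openConn y b)ᶜ ∩ ((openConn a c)ᶜ ∩ (openConn y c)ᶜ)) _ from
    (((oc a b c y 0 1 rfl rfl).compl.inter (oc a b c y 3 1 rfl rfl).compl).inter ((oc a b c y 0 2 rfl rfl).compl.inter (oc a b c y 3 2 rfl rfl).compl)))]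
  simp (config := {decide := true}) only [ite_true, ite_false]; ring

/-- `μ((openConn a b)ᶜ ∩ (openConn a c)ᶜ ∩ (openConn b c)ᶜ)` as a sum of four-point cells. [this work] -/
theorem real_shk_ABC : (prodBernoulli w).real ((openConn a b)ᶜ ∩ (openConn a c)ᶜ ∩ (openConn b c)ᶜ) =
    cell w a b c y 0 + cell w a b c y 1 + cell w a b c y 2 + cell w a b c y 4 := by
  rw [measureReal_eq_cellSum w a b c y (show HasPattern (quad a b c y) ((openConn a b)ᶜ ∩ (openConn a c)ᶜ ∩ (openConn b c)ᶜ) _ from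
    (((oc a b c y 0 1 rfl rfl).compl.inter (oc a b c y 0 2 rfl rfl).compl).inter (oc a b c y 1 2 rfl rfl).compl))]
  simp (config := {decide := true}) only [ite_true, ite_false]; ring

/-- `μ((openConn a c)ᶜ ∩ (openConn b c)ᶜ)` as a sum of four-point cells. [this work] -/
theorem real_shk_BC : (prodBernoulli w).real ((openConn a c)ᶜ ∩ (openConn b c)ᶜ) =
    cell w a b c y 0 + cell w a b c y 1 + cell w a b c y 2 + cell w a b c y 4 + cell w a b c y 6 + cell w a b c y 11 + cell w a b c y 12 := by
  rw [measureReal_eq_cellSum w a b c y (show HasPattern (quad a b c y) ((openConn a c)ᶜ ∩ (openConn b c)ᶜ) _ from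
    ((oc a b c y 0 2 rfl rfl).compl.inter (oc a b c y 1 2 rfl rfl).compl))]
  simp (config := {decide := true}) only [ite_true, ite_false]; ring

/-- `μ((openConn a b)ᶜ ∩ (openConn b c)ᶜ)` as a sum of four-point cells. [this work] -/
theorem real_shk_AC : (prodBernoulli w).real ((openConn a b)ᶜ ∩ (openConn b c)ᶜ) =
    cell w a b c y 0 + cell w a b c y 1 + cell w a b c y 2 + cell w a b c y 4 + cell w a b c y 5 + cell w a b c y 9 + cell w a b c y 10 := by
  rw [measureReal_eq_cellSum w a b c y (show HasPattern (quad a b c y) ((openConn a b)ᶜ ∩ (openConn b c)ᶜ) _ from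
    ((oc a b c y 0 1 rfl rfl).compl.inter (oc a b c y 1 2 rfl rfl).compl))]
  simp (config := {decide := true}) only [ite_true, ite_false]; ring

/-- `μ((openConn a b)ᶜ ∩ (openConn a c)ᶜ)` as a sum of four-point cells. [this work] -/
theorem real_shk_AB : (prodBernoulli w).real ((openConn a b)ᶜ ∩ (openConn a c)ᶜ) =
    cell w a b c y 0 + cell w a b c y 1 + cell w a b c y 2 + cell w a b c y 3 + cell w a b c y 4 + cell w a b c y 7 + cell w a b c y 8 := by
  rw [measureReal_eq_cellSum w a b c y (show HasPattern (quad a b c y) ((openConn a b)ᶜ ∩ (openConn a c)ᶜ) _ from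
    ((oc a b c y 0 1 rfl rfl).compl.inter (oc a b c y 0 2 rfl rfl).compl))]
  simp (config := {decide := true}) only [ite_true, ite_false]; ring

end FourPointAtoms

end Summit.CriticalPhenomena.PercolationContinuityZ3.Theorems
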